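import Literature.NumberTheory.EllipticCurves.BSDSelmerCMPConverse
import Literature.NumberTheory.EllipticCurves.BSDSelmerSmithDensityProofs
import Literature.NumberTheory.EllipticCurves.ComplexMultiplicationHasCMIffProofs
import Literature.NumberTheory.EllipticCurves.BSDWave0TunnellProofs
import Literature.NumberTheory.QuadraticFields.ClassNumberOneLandauProofs
import HarnessLib

/-!
# Burungale–Tian's rank-zero `2`-converse and Smith: the even parity Goldfeld conjecture for CM curves

Second *proofs* companion (theorems only: no definition, no named fact, no instance) of
`Literature.NumberTheory.EllipticCurves.BSDSelmerCMPConverse`. A. A. Burungale and Y. Tian,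
*A rank zero `p`-converse to a theorem of Gross–Zagier, Kolyvagin and Rubin*, Ann. of Math. (2)
203 (2026), 1–13 = arXiv:2506.03465, draw from their Theorem 1.1 at `p = 2` (the tree's named
fact `burungaleTian_analyticRank_eq_zero_of_selmerCorank_eq_zero_of_hasCM`: for a CM elliptic
curve `E/ℚ` and any prime `p`, `corank_{ℤ_p} Sel_{p^∞}(E/ℚ) = 0 ⟹ ord_{s=1} L(s, E/ℚ) = 0`) the
headline application of the abstract: *"Along with Smith's work on the distribution of
`2^∞`-Selmer groups, this leads to the first instance of the even parity Goldfeld conjecture: For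
`50%` of the positive square-free integers `n`, we have `ord_{s=1} L(s, E^{(n)}/ℚ) = 0`, where
`E^{(n)} : ny² = x³ − x` is a quadratic twist of the congruent number elliptic curve
`E : y² = x³ − x`"* (and Theorem 1.2, the refined form "for a density one subset of the positive
square-free integers `n ≡ 1, 2, 3 mod 8`", proved in §3.2.1, p. 6, as *"a consequence of
Theorem 3.3* [Smith, J. Amer. Math. Soc. 39 (2026), Thm. 1.2: `corank_{ℤ_2} Sel_{2^∞}(E^{(n)}/ℚ) = 0`
for a density one subset of the square-free positive `n ≡ 1, 2, 3 mod 8`] *and the `2`-converse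
Theorem 1.1"*).

This file proves that mechanism in the tree's vocabulary, for EVERY elliptic curve over `ℚ` with
complex multiplication and in the tree's density convention for quadratic twist families
(`twistDensity`: square-free `d ∈ ℤ` of both signs ordered by `|d|`, `BSDSelmer.lean`), with the
Selmer input taken from the general distribution theorem already vendored in the tree — A. Smith,
*The Birch and Swinnerton-Dyer conjecture implies Goldfeld's conjecture*, arXiv:2503.17619, Thm. 1.1
(`smith_selmerCorank_density W`: corank `0` for density `1/2`, corank `1` for density `1/2`) —
instead of the congruent-number-specific Theorem 3.3:

* `hasCM_quadraticTwist_of_hasCM` (**proved**): quadratic twists of a CM curve are CM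
  (`j(E^d) = j(E)` and the tree's theorem `HasCM ↔ j ∈ cmJInvariants`,
  `hasCM_iff_j_mem_of_heegnerStarkPrime HeegnerStarkPrimeThreeModEight_holds`);
* `twistDensity_analyticRank_eq_zero_of_hasCM_of_burungaleTian` (**the assembly**): for `E/ℚ`
  with CM, Burungale–Tian's fact (`h`), Smith's Thm. 1.1 for `E` (`hS`) and the `2`-parity
  congruence `corank_{ℤ_2} Sel_{2^∞}(E') ≡ ord_{s=1} L(E', s) (mod 2)` for all elliptic `E'/ℚ`
  (`hMon : monsky_selmerCorank_two_mod_two_eq`, Monsky 1996 as in Dokchitser–Dokchitser 2010 §4.6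
  — the display (1.2) of Smith's own proof of his Cor. 1.2) give
  `ord_{s=1} L(E^d, s) = 0` for a set of square-free `d` of density exactly `1/2`. Proof: on the
  density-one set `{corank ≤ 1}` (`twistDensity_selmerCorankTwoInfty_le_one_of`), corank `0`
  implies analytic rank `0` by the `2`-converse applied to the CM curve `E^d`, and analytic rank
  `0` implies corank even, hence `0`; so `{r_an(E^d) = 0}` and `{corank = 0}` agree on a
  density-one set (`twistDensity_congr_of_one`) and the latter has density `1/2`;
* `twistDensity_analyticRank_eq_zero_congruentNumberCurve_of_burungaleTian`: the case
  `E : y² = x³ − x` (`congruentNumberCurve 1`, `j = 1728 ∈ maximalCMJInvariants`).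

Faithfulness notes. (i) What is printed as Theorem 1.2 concerns positive `n ≡ 1, 2, 3 (mod 8)`
(the twists of root number `+1`, Birch–Stephens) with density one inside that class, and rests on
Smith's J. Amer. Math. Soc. theorem for the congruent number family; the statement proved here is
the both-signs, all-residues form "`r_an(E^d) = 0` for density `1/2` of the square-free `d`",
which is what the same argument yields from Smith's arXiv:2503.17619 Thm. 1.1, for any CM curve.
It is a theorem about the tree's named facts, not a transcription of Theorem 1.2. (ii) Nothing is
asserted: the trust base is `{Burungale–Tian Thm. 1.1, Smith 2025 Thm. 1.1, Monsky's 2-parity}`,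
each an undischarged named fact of the tree entering as a hypothesis.

## References

* A. A. Burungale, Y. Tian, Ann. of Math. (2) 203 (2026), 1–13 = arXiv:2506.03465v2: abstract,
  Thm. 1.1, Thm. 1.2, §3.2.1 (Thm. 3.3 and the proof of Thm. 1.2, p. 6). [BurungaleTian2026]
* A. Smith, *The Birch and Swinnerton-Dyer conjecture implies Goldfeld's conjecture*,
  arXiv:2503.17619 (2025), Thm. 1.1 and the proof of Cor. 1.2. [arXiv250317619]
* T. Dokchitser, V. Dokchitser, Ann. of Math. 172 (2010), §4.6 (case `p = 2`: Monsky 1996).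
  [DokchitserDokchitserAnnals2010]
-/

noncomputable section

open scoped Classical

open WeierstrassCurve Literature.NumberTheory.QuadraticFields.BinaryQuadraticForm

namespace Literature.NumberTheory.EllipticCurves

/-- **Quadratic twists of a CM elliptic curve over `ℚ` are CM.** For `E/ℚ` with (geometric)
complex multiplication and `d ≠ 0`, the twist `E^d` (`W.quadraticTwist d`) has complex
multiplication: `j(E^d) = j(E)` (`WeierstrassCurve.j_quadraticTwist`) and, over `ℚ`, `HasCM` is
the condition `j ∈ cmJInvariants` (the tree's theorem
`hasCM_iff_j_mem_of_heegnerStarkPrime HeegnerStarkPrimeThreeModEight_holds`, Silverman *AEC*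
App. C §11). (Directly: `E^d ≅ E` over `ℚ(√d) ⊂ ℚ̄`, so `End_{ℚ̄}(E^d) ≅ End_{ℚ̄}(E)`.)
[cite: SilvermanAEC2009, App. C §11 (C.11.3.1) with X.5.4] -/
theorem hasCM_quadraticTwist_of_hasCM (W : WeierstrassCurve ℚ) [W.IsElliptic] (hCM : W.HasCM)
    {d : ℚ} (hd : d ≠ 0) : (W.quadraticTwist d).HasCM := by
  haveI := W.isElliptic_quadraticTwist hd
  have hiff := hasCM_iff_j_mem_of_heegnerStarkPrime HeegnerStarkPrimeThreeModEight_holds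
  rw [hiff (W.quadraticTwist d), W.j_quadraticTwist hd]
  exact (hiff W).1 hCM

/-- **The even parity Goldfeld conjecture for CM elliptic curves over `ℚ`, from Burungale–Tian's
`2`-converse and Smith's distribution theorem** (Burungale–Tian, Ann. of Math. 203 (2026),
abstract and §3.2.1, proof of Thm. 1.2: *"This is a consequence of Theorem 3.3 and the
`2`-converse Theorem 1.1"*, run with Smith, arXiv:2503.17619, Thm. 1.1 in place of Theorem 3.3).
Let `E/ℚ` be an elliptic curve with complex multiplication (`hCM`). Assume Burungale–Tian's
Theorem 1.1 over `ℚ` (`h`, the tree's named fact, used at `p = 2`), Smith's Thm. 1.1 for `E`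
(`hS : smith_selmerCorank_density W`) and the `2`-parity congruence
`corank_{ℤ_2} Sel_{2^∞}(E'/ℚ) ≡ ord_{s=1} L(E', s) (mod 2)` for every elliptic `E'/ℚ`
(`hMon : monsky_selmerCorank_two_mod_two_eq`). Then `ord_{s=1} L(E^d, s) = 0` for a set of
square-free `d` of density `1/2` (the tree's `twistDensity`, both signs of `d`, ordered by `|d|`).
Proof: on the density-one set `{d : corank_{ℤ_2} Sel_{2^∞}(E^d/ℚ) ≤ 1}`
(`twistDensity_selmerCorankTwoInfty_le_one_of`) the conditions "corank `0`" and
"`ord_{s=1} L(E^d, s) = 0`" agree — corank `0 ⟹` analytic rank `0` is the `2`-converse for the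
CM curve `E^d` (`hasCM_quadraticTwist_of_hasCM`), and analytic rank `0 ⟹` corank even `⟹ 0` —
so they have the same density (`twistDensity_congr_of_one`), namely `1/2` (first clause of `hS`).
[cite: BurungaleTian2026, abstract, Thm. 1.2 and §3.2.1 (arXiv pp. 1–2, 6)]
[cite: arXiv250317619, Thm. 1.1 and Cor. 1.2 (proof)] -/
theorem twistDensity_analyticRank_eq_zero_of_hasCM_of_burungaleTian
    (h : burungaleTian_analyticRank_eq_zero_of_selmerCorank_eq_zero_of_hasCM)
    (hMon : monsky_selmerCorank_two_mod_two_eq) (W : WeierstrassCurve ℚ) [W.IsElliptic]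
    (hCM : W.HasCM) (hS : smith_selmerCorank_density W) :
    twistDensity (fun d ↦ d ≠ 0 ∧ (W.quadraticTwist d).analyticRank = 0) (1 / 2) := by
  have hR := twistDensity_selmerCorankTwoInfty_le_one_of W hS
  have key : ∀ d : ℤ, Squarefree d →
      (d ≠ 0 ∧ selmerCorankTwoInfty (W.quadraticTwist d) ≤ 1) →
        ((d ≠ 0 ∧ selmerCorankTwoInfty (W.quadraticTwist d) = 0) ↔
          (d ≠ 0 ∧ (W.quadraticTwist d).analyticRank = 0)) := by
    rintro d - ⟨hd, hle⟩
    have hd' : ((d : ℤ) : ℚ) ≠ 0 := by exact_mod_cast hd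
    haveI := W.isElliptic_quadraticTwist hd'
    have hCMd : (W.quadraticTwist (d : ℚ)).HasCM := hasCM_quadraticTwist_of_hasCM W hCM hd'
    have hpar : (W.quadraticTwist (d : ℚ)).selmerCorank 2 % 2 =
        (W.quadraticTwist (d : ℚ)).analyticRank % 2 := hMon _
    rw [← selmerCorankTwoInfty_eq] at hpar
    refine ⟨fun h0 ↦ ⟨hd, h _ hCMd 2 ((selmerCorankTwoInfty_eq _).symm.trans h0.2)⟩,
      fun h0 ↦ ⟨hd, ?_⟩⟩
    have h0' := h0.2
    omega
  exact (twistDensity_congr_of_one hR key).1 hS.1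

/-- **The congruent number curve** (Burungale–Tian 2026, abstract: *"the first instance of the
even parity Goldfeld conjecture … `E : y² = x³ − x`"*, in the form of
`twistDensity_analyticRank_eq_zero_of_hasCM_of_burungaleTian`): for `E : y² = x³ − x`
(`congruentNumberCurve 1`, `j(E) = 1728 ∈ maximalCMJInvariants`, hence CM by
`hasCM_of_j_mem_maximalCMJInvariants_holds`), Burungale–Tian's `2`-converse, Smith's Thm. 1.1 for
`E` and Monsky's `2`-parity give `ord_{s=1} L(E^d, s) = 0` for density `1/2` of the square-free
`d` (both signs, ordered by `|d|`; the printed Theorem 1.2 is the finer statement "density one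
among the positive square-free `n ≡ 1, 2, 3 (mod 8)`", from Smith's J. Amer. Math. Soc. theorem
for this family, not formalised here). [cite: BurungaleTian2026, abstract and Thm. 1.2 (arXiv pp. 1–2)]
[cite: arXiv250317619, Thm. 1.1] -/
theorem twistDensity_analyticRank_eq_zero_congruentNumberCurve_of_burungaleTian
    (h : burungaleTian_analyticRank_eq_zero_of_selmerCorank_eq_zero_of_hasCM)
    (hMon : monsky_selmerCorank_two_mod_two_eq)
    (hS : smith_selmerCorank_density (congruentNumberCurve 1)) :
    twistDensity
      (fun d ↦ d ≠ 0 ∧ ((congruentNumberCurve 1).quadraticTwist d).analyticRank = 0) (1 / 2) := by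
  haveI := isElliptic_congruentNumberCurve one_ne_zero
  exact twistDensity_analyticRank_eq_zero_of_hasCM_of_burungaleTian h hMon (congruentNumberCurve 1)
    (hasCM_of_j_mem_maximalCMJInvariants_holds _ (congruentNumberCurve_j_mem_maximalCMJInvariants 1))
    hS

end Literature.NumberTheory.EllipticCurves

end
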